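import Literature.MathematicalPhysics.QuantumFieldTheory.Balaban1983to89.B15Prop1SliceNondegeneracyFromRealCoercive
import Literature.MathematicalPhysics.QuantumFieldTheory.Balaban1983to89.B16Ineq17NearFlatWilsonLettersLocal
import Literature.MathematicalPhysics.QuantumFieldTheory.Balaban1983to89.Node00.WilsonActionSecondVariationLeftChart
import Literature.MathematicalPhysics.QuantumFieldTheory.Balaban1983to89.B16Ineq19NearFlatSlice
import HarnessLib

/-!
# DAG node N12 [B15] — THE MULTIPLIER LETTER (M) OF THE (β)-SPLIT, REDUCED TO (45)∕(P5)-CURRENCY LETTERS: `Re ℓ₀(D²Φ₀(0)[p̂,p̂]) ≤ m·Σ_b‖p_b‖²` for EVERY multiplier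
# `ℓ₀` of the base state, from a SLICE PREIMAGE of the curvature datum supported near `Ω₁(Z)` (the (45) right inverse in its true, level-`0`-free, slice-valued form), the
# bondwise near-flat row (δ), and a chart-curvature letter — with `m := 8(d−1)·δ·B₁·M₂`

[Balaban1989LargeFieldII] = «[LF-II]», p. 357, (1.12)–(1.13) p. 359 («λ·D²Ψ» — the multiplier term); [Balaban1985Variational] = «[15]», Sect. C (45) p. 285, (82)–(83) p. 290,
Sect. G pp. 305–307; [Balaban1985BackgroundPropagators] (3.7) p. 391 (the first variation ∕ the current).

Cell `pub-ymgap` (HUMAN RULINGS D-0062 ∕ D-0149), WIDTH SEAT `pub-ymgap-dag-n12-w6` generation 14 (node N12 = [B15]; director-ym R463-ym clone-by-row «N12 (P4)»; bus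
2026-08-29 DAGN12W6-G14 CLAIM-1).  Key K1⁹ `stmt-QuantumFields-27364`, `--kind proof --supports … --as helper`; count-neutral; THEOREMS ONLY (0 `def`, 0 `instance`, 0 `sorry`).
CONSUMED BY NAME, nothing modified: dag-n12-w1's `B15Prop1SliceNondegeneracyFromRealCoercive.fderiv_sliceAction_apply_cplxVec` (`Da(0)` is real on real slice directions and equals the
line derivative of the Wilson action), dag-n12-w4's plaquette-budget current `B16Ineq17NearFlatWilsonLettersLocal.abs_fderiv_wilsonAction4_expChart_apply_le_l1_local`, dag-n12-w2's left-chart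
dictionary `Node00.expMul_su2Chart_smul_eq_expChart` ∕ `Node00.norm_coe_specialUnitaryAd` ∕ `B16Ineq19NearFlatSlice.norm_coe_lieSU2Coord`, dag-n12-w3's `B16Ineq19FlatSliceChart.exists_lieSU2Coord`,
`B16Ineq17NearFlatWilsonLetters.fderiv_wilsonAction4_expChart_apply_eq_deriv`.

WHY.  The lane owner's (β)-split of the (J0′) producer (dag-n12-c g25, `B15Prop1RealCoerciveFromNearFlatExpansion.realSecondVariation_pos_of_flatCoercive_of_multiplier` ∕
`…N12MinimiserFamilyOfClassNearFlatCoercive`) displays per base field, next to (δ), (K0) and the flat coercivity (P), the MULTIPLIER LETTER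
  (M) `∀ ℓ₀, fderiv ℂ a 0 = ℓ₀ ∘L fderiv ℂ Φ₀ 0 → ∀ p (hp : cplxVec p ∈ S), fderiv ℂ Φ₀ 0 p̂ = 0 → (ℓ₀ (fderiv ℂ (fderiv ℂ Φ₀) 0 p̂ p̂)).re ≤ m·Σ_b‖p b‖²`
«(45) right inverse × first variation × chart curvature — per-height inhabitable from the (P4)′∕(P5) letters».  THIS FILE performs that multiplication once and for all, for ANY slice
`S`, ANY target space of `Φ₀`, ANY bond set `B₀`: if the curvature datum `u := D²Φ₀(0)[p̂,p̂]` has a slice preimage `ŷ₁ + I•ŷ₂` whose REAL part `y₁` vanishes off `B₀` with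
`Σ_b‖y₁ b‖ ≤ B₁‖u‖` (letter (R1) — the (45) right inverse with the support clause in its TRUE form: level-`0`-free data have preimages inside `Ω₁(Z)`), if `‖u‖ ≤ M₂·Σ_b‖p b‖²` (letter (R2),
(P5) currency) and if `U₀` is bondwise `δ`-flat on the plaquettes meeting `B₀` (the (δ) row verbatim), then (M) holds with `m := 8(d−1)·δ·B₁·M₂`: `ℓ₀ u = Da(0)(ŷ₁ + I•ŷ₂) = A′[y₁] + I·A′[y₂]`
with `A′[y] := d∕ds A(exp(s y)·U₀)|₀ ∈ ℝ`, so `Re ℓ₀ u = A′[y₁]`, and the first variation at a background `δ`-flat near the support of `y₁` is `≤ 8(d−1)δ·Σ_b‖y₁ b‖` (§2).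

CONTENTS (namespace `Summit.QuantumFields.YangMills.BalabanUVNodes.N12MultiplierLetterOfSlicePreimage`; theorems only).
* §1 `re_multiplier_apply_eq_of_comp` — the abstract `ℓ₀`-elimination: `Da(0) = ℓ₀ ∘ DΦ₀(0)` and `DΦ₀(0) x = u` give `ℓ₀ u = Da(0) x`.
* §2 ★ `abs_deriv_wilsonAction4_expMul_su2Chart_le_l1_local` — THE FIRST VARIATION ALONG THE SLICE CHAIN'S CHART, support-local, BONDWISE currency (the (δ) row):
  `A` vanishing off `B₀`, `‖↑U₀(b) − 1‖ ≤ δ` on the four bonds of every plaquette meeting `B₀` ⟹ `|d∕ds A(expMul su2Chart (s•A) U₀)|₀| ≤ 8(d−1)·δ·Σ_b‖A b‖`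
  (the tree had only the SECOND-variation editions `B16Ineq19NearFlatSlice.abs_deriv_deriv_…_sub_one_le(_local)`); `abs_fderiv_wilsonAction4_expChart_apply_le_l1_of_plaqSmall` (NODE 00's right
  chart, ANY bond set, PLAQUETTE budget `‖U(∂q) − 1‖ ≤ εP` on the plaquettes meeting `B₀` ⟹ `≤ 2(d−1)·εP·Σ_b‖X_b‖`; dag-n12-w4's Ω₁-edition generalised) and ★
  `abs_deriv_wilsonAction4_expMul_su2Chart_le_l1_of_plaqSmall` (the same along the slice chain's chart — gauge-INVARIANT input).
* §3 `re_fderiv_sliceAction_le_of_support(_plaq)` (`Re Da(0)(ŷ₁ + I•ŷ₂) = A′[y₁] ≤ …`), ★★★ `multiplierLetter_of_slicePreimage` — the (M) row VERBATIM from (R1) + (R2) + (δ),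
  `m := 8(d−1)·δ·B₁·M₂`; ★★★ `multiplierLetter_of_slicePreimage_plaq` — the same from the PLAQUETTE letter, `m := 2(d−1)·εP·B₁·M₂` (no gauge normalisation of `U₀`); ★★
  `multiplierLetter_of_rightInverseOn` — (M) from a slice right-inverse letter on a CLASS of data `Adm` (at the record: level-`0`-free data) + «curvature data are admissible» + (R2) + (δ).

HONEST FRAMING.  A reduction by name plus one first-variation calculus lemma; the letters (R1) (slice preimage with support and `ℓ¹` bound — producers: this lineage's (P4)′ right inverse
p690553 ∕ p705019 + forest projection + the lane's level-`0` dictionary, a separate file) and (R2) (chart curvature) stay DISPLAYED; per-height constants, NOT print's volume-uniform `O(1)`;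
nothing of Bałaban's (1.7)–(1.9) ∕ (1.12) ∕ (45) is asserted; N12 NOT discharged; K1⁹ NOT closed; counts of record unmoved (typed 28∕28 · discharged 8∕27); one finite 𝕋⁴ programme at
fixed ε — R4 closes the conditional rung `BalabanLadder.UV` only; no summit statement is proved here and NOT the Yang–Mills mass gap (Clay); nothing continuum ∕ ℝ⁴ ∕ OS.
-/

noncomputable section

open scoped BigOperators Matrix.Norms.L2Operator Topology ComplexConjugate

namespace Summit.QuantumFields.YangMills.BalabanUVNodes.N12MultiplierLetterOfSlicePreimage

open Literature.MathematicalPhysics.QuantumFieldTheory.Balaban1983to89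
open Literature.MathematicalPhysics.QuantumFieldTheory.Balaban1983to89.Node00 (SU coeField expChart expMul_su2Chart_smul_eq_expChart norm_coe_specialUnitaryAd
  abs_deriv_wilsonAction4_expChart_zero_le_local sum_plaq_boundary_eq)
open Literature.MathematicalPhysics.QuantumLattice (quatMatrix)
open T4Continuum GaugeField
open T4HaarSU2ExpChart (imQuat)
open T4AdjointCovarianceUnitary (lieSU specialUnitaryAd)
open T4CubeChartGnomonic (SU2)
open B15SU2ChartHolomorphic (expMulC)
open B15Prop1AnalyticExtClause (cplxVec)
open B15Prop1ChartCalculusSU2 (E3)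
open B15Prop1ChartSU2 (su2Chart)
open B16Sect1Backgrounds (expMul)
open B16Ineq19FlatSliceChart (exists_lieSU2Coord)
open B16Ineq19NearFlatSlice (norm_coe_lieSU2Coord)
open B16Ineq17NearFlatWilsonLetters (fderiv_wilsonAction4_expChart_apply_eq_deriv)
open B16Ineq17NearFlatWilsonLettersLocal (abs_fderiv_wilsonAction4_expChart_apply_le_l1_local)
open B15Prop1SliceNondegeneracyFromRealCoercive (fderiv_sliceAction_apply_cplxVec)

variable {P : Params}

/-! ## §1  The abstract `ℓ₀`-elimination -/

section Abstract

variable {E F : Type*} [NormedAddCommGroup E] [NormedSpace ℂ E] [NormedAddCommGroup F] [NormedSpace ℂ F]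

/-- **`ℓ₀`-ELIMINATION**: if the first variation factors through the linearised constraint, `δa = ℓ₀ ∘ D`, then on any preimage `x` of a datum `u` (`D x = u`) the multiplier IS the first
variation: `ℓ₀ u = δa x` — [LF-II]'s reading of the multiplier term `λ·D²Ψ` of (1.12) through (45). [cite: Balaban1989LargeFieldII, (1.12)–(1.13) p.359; Balaban1985Variational, (45) p.285, (82)–(83) p.290] -/
theorem re_multiplier_apply_eq_of_comp {D : E →L[ℂ] F} {δa : E →L[ℂ] ℂ} {ℓ₀ : F →L[ℂ] ℂ} (hℓ : δa = ℓ₀.comp D) {x : E} {u : F} (hx : D x = u) :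
    ℓ₀ u = δa x := by
  rw [hℓ, ContinuousLinearMap.comp_apply, hx]

end Abstract

/-! ## §2  The first variation along the slice chain's chart `s ↦ exp(s A)·U₀`, support-local, bondwise currency -/

section FirstVariation

variable {k : ℕ}

/-- ★ **THE FIRST VARIATION ALONG THE SLICE CHAIN'S CHART IS SMALL AT A BACKGROUND NEAR-FLAT NEAR THE SUPPORT** (bondwise currency, the (δ) row of the (β)-split): if the
`ℝ³`-valued bond field `A` vanishes off a bond set `B₀` and the four bond variables of every plaquette MEETING `B₀` are within `δ` of `1`, then
`|d∕ds A(exp(sA)·U₀)|₀| ≤ 8(d−1)·δ·Σ_b‖A b‖` — dag-n12-w2's left-chart dictionary `exp(sÂ_b)·U₀,b = U₀,b·exp(s·Ad(U₀,b⁻¹)Â_b)` (an operator-norm isometry bondwise, support preserved) and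
dag-n12-w4's plaquette-budget current `|D(A∘expChart U₀)(0)X| ≤ 8(d−1)δ·Σ_b‖X_b‖`. [cite: Balaban1989LargeFieldII, (1.12) p.359, p.357; Balaban1985BackgroundPropagators, (3.7) p.391; Balaban1985Variational, (2) p.278] -/
theorem abs_deriv_wilsonAction4_expMul_su2Chart_le_l1_local (A : VecField P k E3) (U₀ : GaugeField P k SU2) (B₀ : Set (PBond P k))
    (hA : ∀ b ∉ B₀, A b = 0) {δ : ℝ}
    (hU : ∀ p : Plaq P k, ((⟨p.src, p.μ⟩ : PBond P k) ∈ B₀ ∨ (⟨p.src.shift p.μ, p.ν⟩ : PBond P k) ∈ B₀ ∨ (⟨p.src.shift p.ν, p.μ⟩ : PBond P k) ∈ B₀ ∨ (⟨p.src, p.ν⟩ : PBond P k) ∈ B₀) →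
      ‖((U₀ ⟨p.src, p.μ⟩ : SU2) : Matrix (Fin 2) (Fin 2) ℂ) - 1‖ ≤ δ ∧ ‖((U₀ ⟨p.src.shift p.μ, p.ν⟩ : SU2) : Matrix (Fin 2) (Fin 2) ℂ) - 1‖ ≤ δ
        ∧ ‖((U₀ ⟨p.src.shift p.ν, p.μ⟩ : SU2) : Matrix (Fin 2) (Fin 2) ℂ) - 1‖ ≤ δ ∧ ‖((U₀ ⟨p.src, p.ν⟩ : SU2) : Matrix (Fin 2) (Fin 2) ℂ) - 1‖ ≤ δ) :
    |deriv (fun s : ℝ => wilsonAction4 (expMul su2Chart (s • A) U₀)) 0| ≤ 8 * ((P.d : ℝ) - 1) * δ * ∑ b : PBond P k, ‖A b‖ := by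
  obtain ⟨φ, hφ⟩ := exists_lieSU2Coord
  -- the right-chart direction `X_b := Ad(U₀,b⁻¹)(φ(A_b))`
  set X : PBond P k → lieSU (Fin 2) := fun b => specialUnitaryAd (U₀ b)⁻¹ (φ (A b)) with hXdef
  have hcurve : (fun s : ℝ => wilsonAction4 (expMul su2Chart (s • A) U₀)) = fun s : ℝ => wilsonAction4 (expChart U₀ (s • X)) := by
    funext s
    rw [expMul_su2Chart_smul_eq_expChart hφ A U₀ s]
  have hXsupp : ∀ b ∉ B₀, X b = 0 := fun b hb => by
    simp only [hXdef, hA b hb, map_zero]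
  have hXnorm : ∀ b, ‖(X b : Matrix (Fin 2) (Fin 2) ℂ)‖ = ‖A b‖ := fun b => by
    simp only [hXdef]
    rw [norm_coe_specialUnitaryAd, norm_coe_lieSU2Coord hφ]
  rw [hcurve, ← fderiv_wilsonAction4_expChart_apply_eq_deriv U₀ X]
  have h := abs_fderiv_wilsonAction4_expChart_apply_le_l1_local (N := 2) U₀ X B₀ hXsupp hU
  simpa only [hXnorm] using h

/-- **PLAQUETTE-BUDGET EDITION, RIGHT CHART, ANY BOND SET** (gauge-INVARIANT currency): if `X` vanishes off `B₀` and `‖U(∂q) − 1‖ ≤ εP` for every plaquette `q` MEETING `B₀` (one of its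
four bonds in `B₀`), then `|D(A∘expChart U)(0) X| ≤ 2(d−1)·εP·Σ_b‖X_b‖` — NODE 00's plaquette-budget first variation with budget `εP` on the plaquettes meeting `B₀` and `2` elsewhere (where the
four letters of `X` vanish), and the incidence count `Σ_q Σ_{b∈∂q} = 2(d−1)Σ_b` (dag-n12-w4's `…N12DirectChartLetterCore.abs_fderiv_wilsonAction4_expChart_apply_le_of_plaqSmall` is the case
`B₀ = {b | b₋ ∈ Ω₁(Z)}`). [cite: Balaban1989LargeFieldII, (1.12) p.359; Balaban1989LargeFieldI, (8) p.279; Balaban1985BackgroundPropagators, (3.7) p.391] -/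
theorem abs_fderiv_wilsonAction4_expChart_apply_le_l1_of_plaqSmall {N : ℕ} [NeZero N] (U : GaugeField P k (SU N)) (X : PBond P k → lieSU (Fin N)) (B₀ : Set (PBond P k))
    (hX : ∀ b ∉ B₀, X b = 0) {εP : ℝ}
    (hP : ∀ p : Plaq P k, ((⟨p.src, p.μ⟩ : PBond P k) ∈ B₀ ∨ (⟨p.src.shift p.μ, p.ν⟩ : PBond P k) ∈ B₀ ∨ (⟨p.src.shift p.ν, p.μ⟩ : PBond P k) ∈ B₀ ∨ (⟨p.src, p.ν⟩ : PBond P k) ∈ B₀) →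
      ‖((GaugeField.plaqHol U p : SU N) : Matrix (Fin N) (Fin N) ℂ) - 1‖ ≤ εP) :
    |fderiv ℝ (fun Y : PBond P k → lieSU (Fin N) => wilsonAction4 (expChart U Y)) 0 X|
      ≤ 2 * ((P.d : ℝ) - 1) * εP * ∑ b : PBond P k, ‖(X b : Matrix (Fin N) (Fin N) ℂ)‖ := by
  classical
  rw [fderiv_wilsonAction4_expChart_apply_eq_deriv]
  -- budget: `εP` on the plaquettes meeting `B₀`, `2` elsewhere
  let bud : Plaq P k → ℝ := fun p =>
    if ((⟨p.src, p.μ⟩ : PBond P k) ∈ B₀ ∨ (⟨p.src.shift p.μ, p.ν⟩ : PBond P k) ∈ B₀ ∨ (⟨p.src.shift p.ν, p.μ⟩ : PBond P k) ∈ B₀ ∨ (⟨p.src, p.ν⟩ : PBond P k) ∈ B₀) then εP else 2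
  have htwo : ∀ p : Plaq P k, ‖((GaugeField.plaqHol U p : SU N) : Matrix (Fin N) (Fin N) ℂ) - 1‖ ≤ 2 := fun p => by
    calc ‖((GaugeField.plaqHol U p : SU N) : Matrix (Fin N) (Fin N) ℂ) - 1‖
        ≤ ‖((GaugeField.plaqHol U p : SU N) : Matrix (Fin N) (Fin N) ℂ)‖ + ‖(1 : Matrix (Fin N) (Fin N) ℂ)‖ := norm_sub_le _ _
      _ ≤ 1 + 1 := by
          gcongr
          · exact (CStarRing.norm_of_mem_unitary (GaugeField.plaqHol U p).2.1).le
          · exact norm_one.le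
      _ = 2 := by norm_num
  have hbud : ∀ p : Plaq P k, ‖((GaugeField.plaqHol U p : SU N) : Matrix (Fin N) (Fin N) ℂ) - 1‖ ≤ bud p := by
    intro p
    by_cases h : ((⟨p.src, p.μ⟩ : PBond P k) ∈ B₀ ∨ (⟨p.src.shift p.μ, p.ν⟩ : PBond P k) ∈ B₀ ∨ (⟨p.src.shift p.ν, p.μ⟩ : PBond P k) ∈ B₀ ∨ (⟨p.src, p.ν⟩ : PBond P k) ∈ B₀)
    · have hb : bud p = εP := if_pos h
      rw [hb]; exact hP p h
    · have hb : bud p = 2 := if_neg h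
      rw [hb]; exact htwo p
  have hmain := abs_deriv_wilsonAction4_expChart_zero_le_local U X bud hbud
  have hterm : ∀ p : Plaq P k, bud p * (‖(X ⟨p.src, p.μ⟩ : Matrix (Fin N) (Fin N) ℂ)‖ + ‖(X ⟨p.src.shift p.μ, p.ν⟩ : Matrix (Fin N) (Fin N) ℂ)‖
        + ‖(X ⟨p.src.shift p.ν, p.μ⟩ : Matrix (Fin N) (Fin N) ℂ)‖ + ‖(X ⟨p.src, p.ν⟩ : Matrix (Fin N) (Fin N) ℂ)‖)
      ≤ εP * (‖(X ⟨p.src, p.μ⟩ : Matrix (Fin N) (Fin N) ℂ)‖ + ‖(X ⟨p.src.shift p.μ, p.ν⟩ : Matrix (Fin N) (Fin N) ℂ)‖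
        + ‖(X ⟨p.src.shift p.ν, p.μ⟩ : Matrix (Fin N) (Fin N) ℂ)‖ + ‖(X ⟨p.src, p.ν⟩ : Matrix (Fin N) (Fin N) ℂ)‖) := by
    intro p
    by_cases h : ((⟨p.src, p.μ⟩ : PBond P k) ∈ B₀ ∨ (⟨p.src.shift p.μ, p.ν⟩ : PBond P k) ∈ B₀ ∨ (⟨p.src.shift p.ν, p.μ⟩ : PBond P k) ∈ B₀ ∨ (⟨p.src, p.ν⟩ : PBond P k) ∈ B₀)
    · have hb : bud p = εP := if_pos h
      rw [hb]
    · simp only [not_or] at h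
      obtain ⟨h1, h2, h3, h4⟩ := h
      rw [hX _ h1, hX _ h2, hX _ h3, hX _ h4]
      simp
  calc |deriv (fun s : ℝ => wilsonAction4 (expChart U (s • X))) 0|
      ≤ ∑ p : Plaq P k, bud p * (‖(X ⟨p.src, p.μ⟩ : Matrix (Fin N) (Fin N) ℂ)‖ + ‖(X ⟨p.src.shift p.μ, p.ν⟩ : Matrix (Fin N) (Fin N) ℂ)‖
        + ‖(X ⟨p.src.shift p.ν, p.μ⟩ : Matrix (Fin N) (Fin N) ℂ)‖ + ‖(X ⟨p.src, p.ν⟩ : Matrix (Fin N) (Fin N) ℂ)‖) := hmain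
    _ ≤ ∑ p : Plaq P k, εP * (‖(X ⟨p.src, p.μ⟩ : Matrix (Fin N) (Fin N) ℂ)‖ + ‖(X ⟨p.src.shift p.μ, p.ν⟩ : Matrix (Fin N) (Fin N) ℂ)‖
        + ‖(X ⟨p.src.shift p.ν, p.μ⟩ : Matrix (Fin N) (Fin N) ℂ)‖ + ‖(X ⟨p.src, p.ν⟩ : Matrix (Fin N) (Fin N) ℂ)‖) := Finset.sum_le_sum fun p _ => hterm p
    _ = εP * (2 * ((P.d : ℝ) - 1) * ∑ b : PBond P k, ‖(X b : Matrix (Fin N) (Fin N) ℂ)‖) := by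
        rw [← Finset.mul_sum, sum_plaq_boundary_eq (fun b : PBond P k => ‖(X b : Matrix (Fin N) (Fin N) ℂ)‖)]
    _ = 2 * ((P.d : ℝ) - 1) * εP * ∑ b : PBond P k, ‖(X b : Matrix (Fin N) (Fin N) ℂ)‖ := by ring

/-- ★ **PLAQUETTE-BUDGET EDITION ALONG THE SLICE CHAIN'S CHART** (gauge-INVARIANT currency — the direct road's P1 letter ∕ the class of record's plaquette smallness): if `A` vanishes off `B₀`
and `‖U₀(∂q) − 1‖ ≤ εP` on every plaquette meeting `B₀`, then `|d∕ds A(exp(sA)·U₀)|₀| ≤ 2(d−1)·εP·Σ_b‖A b‖`. [cite: Balaban1989LargeFieldII, (1.12) p.359, p.357; Balaban1989LargeFieldI, (8) p.279; Balaban1985BackgroundPropagators, (3.7) p.391] -/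
theorem abs_deriv_wilsonAction4_expMul_su2Chart_le_l1_of_plaqSmall (A : VecField P k E3) (U₀ : GaugeField P k SU2) (B₀ : Set (PBond P k))
    (hA : ∀ b ∉ B₀, A b = 0) {εP : ℝ}
    (hP : ∀ p : Plaq P k, ((⟨p.src, p.μ⟩ : PBond P k) ∈ B₀ ∨ (⟨p.src.shift p.μ, p.ν⟩ : PBond P k) ∈ B₀ ∨ (⟨p.src.shift p.ν, p.μ⟩ : PBond P k) ∈ B₀ ∨ (⟨p.src, p.ν⟩ : PBond P k) ∈ B₀) →
      ‖((GaugeField.plaqHol U₀ p : SU2) : Matrix (Fin 2) (Fin 2) ℂ) - 1‖ ≤ εP) :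
    |deriv (fun s : ℝ => wilsonAction4 (expMul su2Chart (s • A) U₀)) 0| ≤ 2 * ((P.d : ℝ) - 1) * εP * ∑ b : PBond P k, ‖A b‖ := by
  obtain ⟨φ, hφ⟩ := exists_lieSU2Coord
  set X : PBond P k → lieSU (Fin 2) := fun b => specialUnitaryAd (U₀ b)⁻¹ (φ (A b)) with hXdef
  have hcurve : (fun s : ℝ => wilsonAction4 (expMul su2Chart (s • A) U₀)) = fun s : ℝ => wilsonAction4 (expChart U₀ (s • X)) := by
    funext s
    rw [expMul_su2Chart_smul_eq_expChart hφ A U₀ s]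
  have hXsupp : ∀ b ∉ B₀, X b = 0 := fun b hb => by
    simp only [hXdef, hA b hb, map_zero]
  have hXnorm : ∀ b, ‖(X b : Matrix (Fin 2) (Fin 2) ℂ)‖ = ‖A b‖ := fun b => by
    simp only [hXdef]
    rw [norm_coe_specialUnitaryAd, norm_coe_lieSU2Coord hφ]
  rw [hcurve, ← fderiv_wilsonAction4_expChart_apply_eq_deriv U₀ X]
  have h := abs_fderiv_wilsonAction4_expChart_apply_le_l1_of_plaqSmall (N := 2) U₀ X B₀ hXsupp hP
  simpa only [hXnorm] using h

end FirstVariation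

/-! ## §3  The multiplier letter (M) from a slice preimage of the curvature datum -/

section Multiplier

variable (S : Submodule ℂ (VecField P 0 (EuclideanSpace ℂ (Fin 3))))
variable {U₀ : GaugeField P 0 SU2} {a : S → ℂ}
  (ha : ∀ X : S, a X = ∑ q : Plaq P 0, (1 - (expMulC (X : VecField P 0 (EuclideanSpace ℂ (Fin 3))) (coeField U₀) ⟨q.src, q.μ⟩ *
    expMulC (X : VecField P 0 (EuclideanSpace ℂ (Fin 3))) (coeField U₀) ⟨q.src.shift q.μ, q.ν⟩ *
    Matrix.adjugate (expMulC (X : VecField P 0 (EuclideanSpace ℂ (Fin 3))) (coeField U₀) ⟨q.src.shift q.ν, q.μ⟩) *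
    Matrix.adjugate (expMulC (X : VecField P 0 (EuclideanSpace ℂ (Fin 3))) (coeField U₀) ⟨q.src, q.ν⟩)).trace / 2))
include ha

/-- **THE REAL PART OF THE SLICE FIRST VARIATION ON `ŷ₁ + I•ŷ₂` IS THE LINE DERIVATIVE OF THE WILSON ACTION ALONG `y₁`** (`Da(0)` is ℂ-linear and REAL on real slice directions,
`fderiv_sliceAction_apply_cplxVec`), hence bounded by §2 when `y₁` vanishes off `B₀` and `U₀` is bondwise `δ`-flat on the plaquettes meeting `B₀`:
`Re Da(0)(ŷ₁ + I•ŷ₂) ≤ 8(d−1)·δ·Σ_b‖y₁ b‖`. [cite: Balaban1989LargeFieldII, (1.12) p.359, p.357; Balaban1989LargeFieldI, Prop. 1 p.194 («real for real arguments»); Balaban1985BackgroundPropagators, (3.7) p.391] -/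
theorem re_fderiv_sliceAction_le_of_support (B₀ : Set (PBond P 0)) {δ : ℝ}
    (hU : ∀ q : Plaq P 0, ((⟨q.src, q.μ⟩ : PBond P 0) ∈ B₀ ∨ (⟨q.src.shift q.μ, q.ν⟩ : PBond P 0) ∈ B₀ ∨ (⟨q.src.shift q.ν, q.μ⟩ : PBond P 0) ∈ B₀ ∨ (⟨q.src, q.ν⟩ : PBond P 0) ∈ B₀) →
      ‖((U₀ ⟨q.src, q.μ⟩ : SU2) : Matrix (Fin 2) (Fin 2) ℂ) - 1‖ ≤ δ ∧ ‖((U₀ ⟨q.src.shift q.μ, q.ν⟩ : SU2) : Matrix (Fin 2) (Fin 2) ℂ) - 1‖ ≤ δ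
        ∧ ‖((U₀ ⟨q.src.shift q.ν, q.μ⟩ : SU2) : Matrix (Fin 2) (Fin 2) ℂ) - 1‖ ≤ δ ∧ ‖((U₀ ⟨q.src, q.ν⟩ : SU2) : Matrix (Fin 2) (Fin 2) ℂ) - 1‖ ≤ δ)
    {y₁ y₂ : VecField P 0 E3} (h₁ : cplxVec y₁ ∈ S) (h₂ : cplxVec y₂ ∈ S) (hy₁ : ∀ b ∉ B₀, y₁ b = 0) :
    (fderiv ℂ a 0 ((⟨cplxVec y₁, h₁⟩ : S) + Complex.I • (⟨cplxVec y₂, h₂⟩ : S))).re ≤ 8 * ((P.d : ℝ) - 1) * δ * ∑ b : PBond P 0, ‖y₁ b‖ := by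
  rw [map_add, map_smul, fderiv_sliceAction_apply_cplxVec S ha h₁, fderiv_sliceAction_apply_cplxVec S ha h₂, Complex.add_re, smul_eq_mul,
    Complex.mul_re, Complex.I_re, Complex.I_im, Complex.ofReal_re, Complex.ofReal_im, Complex.ofReal_re]
  have h := abs_deriv_wilsonAction4_expMul_su2Chart_le_l1_local y₁ U₀ B₀ hy₁ hU
  have h' := (le_abs_self _).trans h
  linarith

/-- ★★★ **THE MULTIPLIER LETTER (M) OF THE (β)-SPLIT FROM A SLICE PREIMAGE OF THE CURVATURE DATUM** — the row displayed per base field by the lane owner's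
`…N12MinimiserFamilyOfClassNearFlatCoercive` ∕ consumed by `B15Prop1RealCoerciveFromNearFlatExpansion.realSecondVariation_pos_of_flatCoercive_of_multiplier`, VERBATIM, with `m := 8(d−1)·δ·B₁·M₂`:
for EVERY multiplier `ℓ₀` with `fderiv ℂ a 0 = ℓ₀ ∘L fderiv ℂ Φ₀ 0` and every real slice kernel direction `p̂ = cplxVec p`, `Re ℓ₀(D²Φ₀(0)[p̂,p̂]) ≤ m·Σ_b‖p b‖²`.  Inputs: the (δ) row (bondwise
`δ`-flatness of `U₀` on the plaquettes meeting `B₀`; at the record `B₀ = {b | b.src ∈ Ω₁(Z)}`), (R1) a slice preimage `ŷ₁ + I•ŷ₂` of the curvature datum whose real part vanishes off `B₀` with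
`Σ_b‖y₁ b‖ ≤ B₁·‖D²Φ₀(0)[p̂,p̂]‖` ([15] (45) — the right inverse with its support clause in the true, level-`0`-free form), (R2) the chart-curvature letter `‖D²Φ₀(0)[p̂,p̂]‖ ≤ M₂·Σ_b‖p b‖²`.
Proof: §1 (`ℓ₀ u = Da(0)(ŷ₁ + I•ŷ₂)`), §2 (`Re ≤ 8(d−1)δ·Σ‖y₁ b‖`), then (R1), (R2). [cite: Balaban1989LargeFieldII, (1.12)–(1.13) p.359, p.357; Balaban1985Variational, Sect. C (45) p.285, (82)–(83) p.290, Sect. G p.305; Balaban1985BackgroundPropagators, (3.7) p.391] -/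
theorem multiplierLetter_of_slicePreimage {F : Type*} [NormedAddCommGroup F] [NormedSpace ℂ F] (Φ₀ : S → F) (B₀ : Set (PBond P 0))
    {δ : ℝ} (hδ0 : 0 ≤ δ)
    (hU : ∀ q : Plaq P 0, ((⟨q.src, q.μ⟩ : PBond P 0) ∈ B₀ ∨ (⟨q.src.shift q.μ, q.ν⟩ : PBond P 0) ∈ B₀ ∨ (⟨q.src.shift q.ν, q.μ⟩ : PBond P 0) ∈ B₀ ∨ (⟨q.src, q.ν⟩ : PBond P 0) ∈ B₀) →
      ‖((U₀ ⟨q.src, q.μ⟩ : SU2) : Matrix (Fin 2) (Fin 2) ℂ) - 1‖ ≤ δ ∧ ‖((U₀ ⟨q.src.shift q.μ, q.ν⟩ : SU2) : Matrix (Fin 2) (Fin 2) ℂ) - 1‖ ≤ δ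
        ∧ ‖((U₀ ⟨q.src.shift q.ν, q.μ⟩ : SU2) : Matrix (Fin 2) (Fin 2) ℂ) - 1‖ ≤ δ ∧ ‖((U₀ ⟨q.src, q.ν⟩ : SU2) : Matrix (Fin 2) (Fin 2) ℂ) - 1‖ ≤ δ)
    {B₁ M₂ : ℝ} (hB₁ : 0 ≤ B₁)
    -- (R1) the slice preimage of the curvature datum, real part supported in `B₀`, with its `ℓ¹` letter
    (hpre : ∀ (p : VecField P 0 E3) (hp : cplxVec p ∈ S), fderiv ℂ Φ₀ 0 ⟨cplxVec p, hp⟩ = 0 →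
      ∃ (y₁ y₂ : VecField P 0 E3) (h₁ : cplxVec y₁ ∈ S) (h₂ : cplxVec y₂ ∈ S),
        fderiv ℂ Φ₀ 0 ⟨cplxVec y₁, h₁⟩ + Complex.I • fderiv ℂ Φ₀ 0 ⟨cplxVec y₂, h₂⟩ = fderiv ℂ (fderiv ℂ Φ₀) 0 ⟨cplxVec p, hp⟩ ⟨cplxVec p, hp⟩ ∧
        (∀ b ∉ B₀, y₁ b = 0) ∧
        ∑ b : PBond P 0, ‖y₁ b‖ ≤ B₁ * ‖fderiv ℂ (fderiv ℂ Φ₀) 0 ⟨cplxVec p, hp⟩ ⟨cplxVec p, hp⟩‖)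
    -- (R2) the chart-curvature letter on real kernel directions
    (hcurv : ∀ (p : VecField P 0 E3) (hp : cplxVec p ∈ S), fderiv ℂ Φ₀ 0 ⟨cplxVec p, hp⟩ = 0 →
      ‖fderiv ℂ (fderiv ℂ Φ₀) 0 ⟨cplxVec p, hp⟩ ⟨cplxVec p, hp⟩‖ ≤ M₂ * ∑ b : PBond P 0, ‖p b‖ ^ 2) :
    ∀ ℓ₀ : F →L[ℂ] ℂ, fderiv ℂ a 0 = ℓ₀.comp (fderiv ℂ Φ₀ 0) →
      ∀ (p : VecField P 0 E3) (hp : cplxVec p ∈ S), fderiv ℂ Φ₀ 0 ⟨cplxVec p, hp⟩ = 0 →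
        (ℓ₀ (fderiv ℂ (fderiv ℂ Φ₀) 0 ⟨cplxVec p, hp⟩ ⟨cplxVec p, hp⟩)).re ≤ (8 * ((P.d : ℝ) - 1) * δ * B₁ * M₂) * ∑ b : PBond P 0, ‖p b‖ ^ 2 := by
  intro ℓ₀ hℓ p hp hker
  obtain ⟨y₁, y₂, h₁, h₂, hsum, hy₁, hB⟩ := hpre p hp hker
  have hMu := hcurv p hp hker
  set u := fderiv ℂ (fderiv ℂ Φ₀) 0 ⟨cplxVec p, hp⟩ ⟨cplxVec p, hp⟩ with hu
  -- `ℓ₀ u = Da(0)(ŷ₁ + I•ŷ₂)`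
  have hx : fderiv ℂ Φ₀ 0 ((⟨cplxVec y₁, h₁⟩ : S) + Complex.I • (⟨cplxVec y₂, h₂⟩ : S)) = u := by
    rw [map_add, map_smul, hsum]
  have hℓu : ℓ₀ u = fderiv ℂ a 0 ((⟨cplxVec y₁, h₁⟩ : S) + Complex.I • (⟨cplxVec y₂, h₂⟩ : S)) := re_multiplier_apply_eq_of_comp hℓ hx
  have hd : 0 ≤ (P.d : ℝ) - 1 := by
    have h1 : (1 : ℝ) ≤ P.d := by exact_mod_cast P.hd
    linarith
  have hc : 0 ≤ 8 * ((P.d : ℝ) - 1) * δ := by positivity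
  calc (ℓ₀ u).re = (fderiv ℂ a 0 ((⟨cplxVec y₁, h₁⟩ : S) + Complex.I • (⟨cplxVec y₂, h₂⟩ : S))).re := by rw [hℓu]
    _ ≤ 8 * ((P.d : ℝ) - 1) * δ * ∑ b : PBond P 0, ‖y₁ b‖ := re_fderiv_sliceAction_le_of_support S ha B₀ hU h₁ h₂ hy₁
    _ ≤ 8 * ((P.d : ℝ) - 1) * δ * (B₁ * ‖u‖) := mul_le_mul_of_nonneg_left hB hc
    _ ≤ 8 * ((P.d : ℝ) - 1) * δ * (B₁ * (M₂ * ∑ b : PBond P 0, ‖p b‖ ^ 2)) := by gcongr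
    _ = (8 * ((P.d : ℝ) - 1) * δ * B₁ * M₂) * ∑ b : PBond P 0, ‖p b‖ ^ 2 := by ring

/-- **PLAQUETTE-BUDGET EDITION** of `re_fderiv_sliceAction_le_of_support` (gauge-invariant currency): `Re Da(0)(ŷ₁ + I•ŷ₂) ≤ 2(d−1)·εP·Σ_b‖y₁ b‖` when `y₁` vanishes off `B₀` and
`‖U₀(∂q) − 1‖ ≤ εP` on the plaquettes meeting `B₀`. [cite: Balaban1989LargeFieldII, (1.12) p.359; Balaban1989LargeFieldI, (8) p.279, Prop. 1 p.194; Balaban1985BackgroundPropagators, (3.7) p.391] -/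
theorem re_fderiv_sliceAction_le_of_support_plaq (B₀ : Set (PBond P 0)) {εP : ℝ}
    (hP : ∀ q : Plaq P 0, ((⟨q.src, q.μ⟩ : PBond P 0) ∈ B₀ ∨ (⟨q.src.shift q.μ, q.ν⟩ : PBond P 0) ∈ B₀ ∨ (⟨q.src.shift q.ν, q.μ⟩ : PBond P 0) ∈ B₀ ∨ (⟨q.src, q.ν⟩ : PBond P 0) ∈ B₀) →
      ‖((GaugeField.plaqHol U₀ q : SU2) : Matrix (Fin 2) (Fin 2) ℂ) - 1‖ ≤ εP)
    {y₁ y₂ : VecField P 0 E3} (h₁ : cplxVec y₁ ∈ S) (h₂ : cplxVec y₂ ∈ S) (hy₁ : ∀ b ∉ B₀, y₁ b = 0) :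
    (fderiv ℂ a 0 ((⟨cplxVec y₁, h₁⟩ : S) + Complex.I • (⟨cplxVec y₂, h₂⟩ : S))).re ≤ 2 * ((P.d : ℝ) - 1) * εP * ∑ b : PBond P 0, ‖y₁ b‖ := by
  rw [map_add, map_smul, fderiv_sliceAction_apply_cplxVec S ha h₁, fderiv_sliceAction_apply_cplxVec S ha h₂, Complex.add_re, smul_eq_mul,
    Complex.mul_re, Complex.I_re, Complex.I_im, Complex.ofReal_re, Complex.ofReal_im, Complex.ofReal_re]
  have h := abs_deriv_wilsonAction4_expMul_su2Chart_le_l1_of_plaqSmall y₁ U₀ B₀ hy₁ hP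
  have h' := (le_abs_self _).trans h
  linarith

/-- ★★★ **THE MULTIPLIER LETTER (M), PLAQUETTE-BUDGET EDITION** (gauge-INVARIANT input: `‖U₀(∂q) − 1‖ ≤ εP` on the plaquettes meeting `B₀` — the direct road's P1 letter ∕ the class of record's
plaquette smallness ∕ [IV] (8), no gauge normalisation of `U₀` needed): (R1) + (R2) ⟹ `Re ℓ₀(D²Φ₀(0)[p̂,p̂]) ≤ (2(d−1)·εP·B₁·M₂)·Σ_b‖p b‖²` for every multiplier `ℓ₀`.
[cite: Balaban1989LargeFieldII, (1.12)–(1.13) p.359, p.357; Balaban1989LargeFieldI, (8) p.279; Balaban1985Variational, Sect. C (45) p.285, (82)–(83) p.290; Balaban1985BackgroundPropagators, (3.7) p.391] -/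
theorem multiplierLetter_of_slicePreimage_plaq {F : Type*} [NormedAddCommGroup F] [NormedSpace ℂ F] (Φ₀ : S → F) (B₀ : Set (PBond P 0))
    {εP : ℝ} (hεP0 : 0 ≤ εP)
    (hP : ∀ q : Plaq P 0, ((⟨q.src, q.μ⟩ : PBond P 0) ∈ B₀ ∨ (⟨q.src.shift q.μ, q.ν⟩ : PBond P 0) ∈ B₀ ∨ (⟨q.src.shift q.ν, q.μ⟩ : PBond P 0) ∈ B₀ ∨ (⟨q.src, q.ν⟩ : PBond P 0) ∈ B₀) →
      ‖((GaugeField.plaqHol U₀ q : SU2) : Matrix (Fin 2) (Fin 2) ℂ) - 1‖ ≤ εP)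
    {B₁ M₂ : ℝ} (hB₁ : 0 ≤ B₁)
    (hpre : ∀ (p : VecField P 0 E3) (hp : cplxVec p ∈ S), fderiv ℂ Φ₀ 0 ⟨cplxVec p, hp⟩ = 0 →
      ∃ (y₁ y₂ : VecField P 0 E3) (h₁ : cplxVec y₁ ∈ S) (h₂ : cplxVec y₂ ∈ S),
        fderiv ℂ Φ₀ 0 ⟨cplxVec y₁, h₁⟩ + Complex.I • fderiv ℂ Φ₀ 0 ⟨cplxVec y₂, h₂⟩ = fderiv ℂ (fderiv ℂ Φ₀) 0 ⟨cplxVec p, hp⟩ ⟨cplxVec p, hp⟩ ∧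
        (∀ b ∉ B₀, y₁ b = 0) ∧
        ∑ b : PBond P 0, ‖y₁ b‖ ≤ B₁ * ‖fderiv ℂ (fderiv ℂ Φ₀) 0 ⟨cplxVec p, hp⟩ ⟨cplxVec p, hp⟩‖)
    (hcurv : ∀ (p : VecField P 0 E3) (hp : cplxVec p ∈ S), fderiv ℂ Φ₀ 0 ⟨cplxVec p, hp⟩ = 0 →
      ‖fderiv ℂ (fderiv ℂ Φ₀) 0 ⟨cplxVec p, hp⟩ ⟨cplxVec p, hp⟩‖ ≤ M₂ * ∑ b : PBond P 0, ‖p b‖ ^ 2) :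
    ∀ ℓ₀ : F →L[ℂ] ℂ, fderiv ℂ a 0 = ℓ₀.comp (fderiv ℂ Φ₀ 0) →
      ∀ (p : VecField P 0 E3) (hp : cplxVec p ∈ S), fderiv ℂ Φ₀ 0 ⟨cplxVec p, hp⟩ = 0 →
        (ℓ₀ (fderiv ℂ (fderiv ℂ Φ₀) 0 ⟨cplxVec p, hp⟩ ⟨cplxVec p, hp⟩)).re ≤ (2 * ((P.d : ℝ) - 1) * εP * B₁ * M₂) * ∑ b : PBond P 0, ‖p b‖ ^ 2 := by
  intro ℓ₀ hℓ p hp hker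
  obtain ⟨y₁, y₂, h₁, h₂, hsum, hy₁, hB⟩ := hpre p hp hker
  have hMu := hcurv p hp hker
  set u := fderiv ℂ (fderiv ℂ Φ₀) 0 ⟨cplxVec p, hp⟩ ⟨cplxVec p, hp⟩ with hu
  have hx : fderiv ℂ Φ₀ 0 ((⟨cplxVec y₁, h₁⟩ : S) + Complex.I • (⟨cplxVec y₂, h₂⟩ : S)) = u := by
    rw [map_add, map_smul, hsum]
  have hℓu : ℓ₀ u = fderiv ℂ a 0 ((⟨cplxVec y₁, h₁⟩ : S) + Complex.I • (⟨cplxVec y₂, h₂⟩ : S)) := re_multiplier_apply_eq_of_comp hℓ hx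
  have hd : 0 ≤ (P.d : ℝ) - 1 := by
    have h1 : (1 : ℝ) ≤ P.d := by exact_mod_cast P.hd
    linarith
  have hc : 0 ≤ 2 * ((P.d : ℝ) - 1) * εP := by positivity
  calc (ℓ₀ u).re = (fderiv ℂ a 0 ((⟨cplxVec y₁, h₁⟩ : S) + Complex.I • (⟨cplxVec y₂, h₂⟩ : S))).re := by rw [hℓu]
    _ ≤ 2 * ((P.d : ℝ) - 1) * εP * ∑ b : PBond P 0, ‖y₁ b‖ := re_fderiv_sliceAction_le_of_support_plaq S ha B₀ hP h₁ h₂ hy₁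
    _ ≤ 2 * ((P.d : ℝ) - 1) * εP * (B₁ * ‖u‖) := mul_le_mul_of_nonneg_left hB hc
    _ ≤ 2 * ((P.d : ℝ) - 1) * εP * (B₁ * (M₂ * ∑ b : PBond P 0, ‖p b‖ ^ 2)) := by gcongr
    _ = (2 * ((P.d : ℝ) - 1) * εP * B₁ * M₂) * ∑ b : PBond P 0, ‖p b‖ ^ 2 := by ring

/-- ★★ **THE MULTIPLIER LETTER (M) FROM A SLICE RIGHT-INVERSE LETTER ON A CLASS OF DATA** — the shape the producers speak: (R1a) every datum `u` of a class `Adm` (at the record: the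
LEVEL-`0`-FREE data, [III] (2.13) `Γ₀ = Ω₁ᶜ`) has a slice preimage `ŷ₁ + I•ŷ₂` with `y₁ = 0` off `B₀` and `Σ_b‖y₁ b‖ ≤ B₁‖u‖` (this lineage's (P4)′ right inverse with `ℓ¹` letter, read on
the slice); (R1b) the curvature data `D²Φ₀(0)[p̂,p̂]` of real kernel directions lie in `Adm` (the level-`0` components of the chart are LINEAR — the level-`0` dictionary); (R2) the curvature
letter; (δ) bondwise.  Then (M) with `m := 8(d−1)·δ·B₁·M₂`. [cite: Balaban1989LargeFieldII, (1.12)–(1.13) p.359; Balaban1985Variational, Sect. C (45) p.285, (82)–(83) p.290; Balaban1988Convergent, (2.13) pp.256–257] -/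
theorem multiplierLetter_of_rightInverseOn {F : Type*} [NormedAddCommGroup F] [NormedSpace ℂ F] (Φ₀ : S → F) (B₀ : Set (PBond P 0))
    {δ : ℝ} (hδ0 : 0 ≤ δ)
    (hU : ∀ q : Plaq P 0, ((⟨q.src, q.μ⟩ : PBond P 0) ∈ B₀ ∨ (⟨q.src.shift q.μ, q.ν⟩ : PBond P 0) ∈ B₀ ∨ (⟨q.src.shift q.ν, q.μ⟩ : PBond P 0) ∈ B₀ ∨ (⟨q.src, q.ν⟩ : PBond P 0) ∈ B₀) →
      ‖((U₀ ⟨q.src, q.μ⟩ : SU2) : Matrix (Fin 2) (Fin 2) ℂ) - 1‖ ≤ δ ∧ ‖((U₀ ⟨q.src.shift q.μ, q.ν⟩ : SU2) : Matrix (Fin 2) (Fin 2) ℂ) - 1‖ ≤ δ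
        ∧ ‖((U₀ ⟨q.src.shift q.ν, q.μ⟩ : SU2) : Matrix (Fin 2) (Fin 2) ℂ) - 1‖ ≤ δ ∧ ‖((U₀ ⟨q.src, q.ν⟩ : SU2) : Matrix (Fin 2) (Fin 2) ℂ) - 1‖ ≤ δ)
    (Adm : F → Prop) {B₁ M₂ : ℝ} (hB₁ : 0 ≤ B₁)
    -- (R1a) slice right inverse with support and `ℓ¹` letter on the class `Adm`
    (hRI : ∀ u : F, Adm u → ∃ (y₁ y₂ : VecField P 0 E3) (h₁ : cplxVec y₁ ∈ S) (h₂ : cplxVec y₂ ∈ S),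
        fderiv ℂ Φ₀ 0 ⟨cplxVec y₁, h₁⟩ + Complex.I • fderiv ℂ Φ₀ 0 ⟨cplxVec y₂, h₂⟩ = u ∧ (∀ b ∉ B₀, y₁ b = 0) ∧ ∑ b : PBond P 0, ‖y₁ b‖ ≤ B₁ * ‖u‖)
    -- (R1b) the curvature data of real kernel directions are admissible
    (hAdm : ∀ (p : VecField P 0 E3) (hp : cplxVec p ∈ S), fderiv ℂ Φ₀ 0 ⟨cplxVec p, hp⟩ = 0 → Adm (fderiv ℂ (fderiv ℂ Φ₀) 0 ⟨cplxVec p, hp⟩ ⟨cplxVec p, hp⟩))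
    -- (R2) the chart-curvature letter
    (hcurv : ∀ (p : VecField P 0 E3) (hp : cplxVec p ∈ S), fderiv ℂ Φ₀ 0 ⟨cplxVec p, hp⟩ = 0 →
      ‖fderiv ℂ (fderiv ℂ Φ₀) 0 ⟨cplxVec p, hp⟩ ⟨cplxVec p, hp⟩‖ ≤ M₂ * ∑ b : PBond P 0, ‖p b‖ ^ 2) :
    ∀ ℓ₀ : F →L[ℂ] ℂ, fderiv ℂ a 0 = ℓ₀.comp (fderiv ℂ Φ₀ 0) →
      ∀ (p : VecField P 0 E3) (hp : cplxVec p ∈ S), fderiv ℂ Φ₀ 0 ⟨cplxVec p, hp⟩ = 0 →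
        (ℓ₀ (fderiv ℂ (fderiv ℂ Φ₀) 0 ⟨cplxVec p, hp⟩ ⟨cplxVec p, hp⟩)).re ≤ (8 * ((P.d : ℝ) - 1) * δ * B₁ * M₂) * ∑ b : PBond P 0, ‖p b‖ ^ 2 :=
  multiplierLetter_of_slicePreimage S ha Φ₀ B₀ hδ0 hU hB₁ (fun p hp hker => hRI _ (hAdm p hp hker)) hcurv

end Multiplier

end Summit.QuantumFields.YangMills.BalabanUVNodes.N12MultiplierLetterOfSlicePreimage

end
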